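import Mathlib
import Literature.Analysis.Complex.SimilarityRegularisation
import Literature.Analysis.Complex.ApproximateHolomorphy
import Literature.Analysis.Complex.ArgumentPrincipleWinding
import Literature.Topology.PlaneTopology.WindingNumber
import HarnessLib

/-!
# The `δ`-regularised similarity principle, global zero-free form

A smooth `G : ℂ → ℂ` with `∂̄ G = r`, `‖r‖ ≤ M ‖G‖`, `r = 0` and `‖G - 1‖ < 1` where
`‖η‖ ≥ ρ₀`, has no zero (`zeroFree_of_dbar_le`); more generally `‖G - c₀‖ < ‖c₀‖` far out for a
constant `c₀ ≠ 0` suffices (`zeroFree_of_dbar_le_of_norm_sub_const_lt`).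

Classically (Carleman–Bers–Vekua; Wendl (2020), App. B Thm B.20; McDuff–Salamon (2012), §2.3)
`|∂̄ G| ≤ M |G|` gives `G = e^s h` with `h` holomorphic, so the zeros of `G` are those of `h` and
are counted by the winding number along a large circle, which vanishes because `‖G - 1‖ < 1`
there. We avoid the discontinuous coefficient `r / G`: with the smooth regularised coefficient
`a = r · conj G / (|G|² + δ)` (`‖a‖ ≤ M`, `‖r - a G‖ ≤ M √δ / 2`,
`Literature/Analysis/Complex/SimilarityRegularisation.lean`) and its Cauchy transform `s = T a`
(`∂̄ s = a`, `‖s‖ ≤ S` on a large disc) the function `h = e^{-s} G` has the same zeros as `G`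
and `‖∂̄ h‖ = ‖e^{-s} (r - a G)‖ ≤ e^S M √δ / 2`; Cauchy–Pompeiu with a cut-off
(`exists_holomorphic_approx_of_dbar_le`) gives `H` holomorphic on a disc with
`‖h - H‖ ≤ C e^S M √δ / 2`. On the circle `‖z‖ = ρ₀ + 1` the loop `h ∘ γ` has winding number `0`
(`e^{-s ∘ γ}` is the exponential of a periodic function, `G ∘ γ` is Rouché-close to `1`) and
`‖h‖ ≥ e^{-S} min ‖G‖`; for `δ` small, Rouché transfers winding number `0` to `(H - H η₀) ∘ γ`,
where `η₀` is a putative zero of `G` (hence of `h`, so `‖H η₀‖` is small too). But `H - H η₀` is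
holomorphic with a zero inside the circle and none on it, so its winding number is non-zero
(`wind_circleLoop_ne_zero_of_zero`): contradiction. No limit `δ → 0` is needed.

Provenance: `Theorems/SullivanDualTameOrBrodyR4HelperZeroFreeOfDbarLe.lean` of summit
`SmoothPoincare4` (crux `TameOrBrodyR4`, the planar heart of Gromov's anchored-pencil
transversality), re-homed (promotion event 3639839) with the normalisation-free form added.

## References

* C. Wendl, *Lectures on Contact 3-Manifolds, Holomorphic Curves and Intersection Theory* (2020),
  App. B, Thm B.20. [Wendl2020]
* D. McDuff, D. Salamon, *J-holomorphic curves and symplectic topology*, 2nd ed. (2012), §2.3.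
  [McDuffSalamon2012]
-/

noncomputable section

open scoped ContDiff ComplexConjugate Topology
open Filter Set Metric
open Literature.Topology.PlaneTopology

namespace Literature.Analysis.Complex

namespace Similarity

/-! ### Loops on the circle `‖z‖ = R` -/


/-- The loop `t ↦ e^{-s(γ t)} G(γ t)` along the circle `γ = circleLoop 0 R` has winding number
`0` as soon as `‖G - 1‖ < 1` on the circle: the exponential factor is the exponential of a
periodic function, and `G ∘ γ` is Rouché-close to the constant loop `1`. [folklore] -/
theorem loop_exp_neg_mul {s G : ℂ → ℂ} (hs : Continuous s) (hG : Continuous G) {R : ℝ}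
    (hfar : ∀ t ∈ Icc (0 : ℝ) 1, ‖G (circleLoop 0 R t) - 1‖ < 1) :
    IsNonvanishingLoop (fun t => Complex.exp (-s (circleLoop 0 R t)) * G (circleLoop 0 R t)) ∧
      wind (fun t => Complex.exp (-s (circleLoop 0 R t)) * G (circleLoop 0 R t)) = 0 := by
  have hGl : IsNonvanishingLoop (fun t => G (circleLoop 0 R t)) := by
    refine ⟨(hG.comp (continuous_circleLoop 0 R)).continuousOn, fun t ht h0 => ?_,
      by rw [circleLoop_zero_eq]⟩
    have := hfar t ht
    rw [h0, zero_sub, norm_neg, norm_one] at this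
    exact lt_irrefl _ this
  have hGw : wind (fun t => G (circleLoop 0 R t)) = 0 :=
    (wind_eq_of_norm_sub_lt hGl.continuousOn hGl.eq_endpoints
      (IsNonvanishingLoop.const one_ne_zero) (fun t ht => by
        rw [norm_one]
        exact hfar t ht)).trans (wind_const 1)
  have hEl : IsNonvanishingLoop (fun t => Complex.exp (-s (circleLoop 0 R t))) :=
    ⟨((hs.comp (continuous_circleLoop 0 R)).neg.cexp).continuousOn,
      fun t _ => Complex.exp_ne_zero _, by rw [circleLoop_zero_eq]⟩
  have hEw : wind (fun t => Complex.exp (-s (circleLoop 0 R t))) = 0 :=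
    wind_exp_eq_zero (l := fun t => -s (circleLoop 0 R t))
      ((hs.comp (continuous_circleLoop 0 R)).neg).continuousOn (by rw [circleLoop_zero_eq])
  exact ⟨hEl.mul hGl, by rw [wind_mul hEl hGl, hEw, hGw, add_zero]⟩

/-- **Rouché packaging.** Let `h` give a loop in `ℂ \ {0}` of winding number `0` along the circle
`‖z‖ = R`, with `‖h‖ ≥ b` on the circle and `h η₀ = 0` for some `‖η₀‖ ≤ R`. If `H` is holomorphic
on a larger disc and `‖h - H‖ ≤ e` on `‖z‖ ≤ R` with `2e < b`, then `H - H η₀` does not vanish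
on the circle and has winding number `0` along it. [folklore] -/
theorem wind_sub_eq_zero {H h : ℂ → ℂ} {ρ' R b e : ℝ} (hR : 0 ≤ R) (hRρ : R < ρ')
    (hH : DifferentiableOn ℂ H (ball 0 ρ'))
    (hloop : IsNonvanishingLoop (fun t => h (circleLoop 0 R t)))
    (hw : wind (fun t => h (circleLoop 0 R t)) = 0)
    (hlow : ∀ z : ℂ, ‖z‖ = R → b ≤ ‖h z‖)
    (happ : ∀ z : ℂ, ‖z‖ ≤ R → ‖h z - H z‖ ≤ e)
    {η₀ : ℂ} (hη₀ : ‖η₀‖ ≤ R) (hh0 : h η₀ = 0) (hbe : 2 * e < b) :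
    (∀ t ∈ Icc (0 : ℝ) 1, H (circleLoop 0 R t) - H η₀ ≠ 0) ∧
      wind (fun t => H (circleLoop 0 R t) - H η₀) = 0 := by
  have hγ : ∀ t, ‖circleLoop 0 R t‖ = R := fun t => by
    simpa using circleLoop_mem_sphere 0 hR t
  have hcont : ContinuousOn (fun t => H (circleLoop 0 R t) - H η₀) (Icc 0 1) := by
    refine ContinuousOn.sub ?_ continuousOn_const
    exact hH.continuousOn.comp (continuous_circleLoop 0 R).continuousOn fun t _ =>
      mem_ball_zero_iff.2 (by rw [hγ]; exact hRρ)
  have h01 : H (circleLoop 0 R 0) - H η₀ = H (circleLoop 0 R 1) - H η₀ := by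
    rw [circleLoop_zero_eq]
  have hH0 : ‖H η₀‖ ≤ e := by simpa [hh0] using happ η₀ hη₀
  have hlt : ∀ t ∈ Icc (0 : ℝ) 1,
      ‖(H (circleLoop 0 R t) - H η₀) - h (circleLoop 0 R t)‖ < ‖h (circleLoop 0 R t)‖ := by
    intro t _
    have h1 := happ (circleLoop 0 R t) (hγ t).le
    have h2 := hlow (circleLoop 0 R t) (hγ t)
    calc ‖H (circleLoop 0 R t) - H η₀ - h (circleLoop 0 R t)‖
        = ‖(H (circleLoop 0 R t) - h (circleLoop 0 R t)) - H η₀‖ := by ring_nf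
      _ ≤ ‖H (circleLoop 0 R t) - h (circleLoop 0 R t)‖ + ‖H η₀‖ := norm_sub_le _ _
      _ ≤ e + e := add_le_add (by rw [norm_sub_rev]; exact h1) hH0
      _ < b := by linarith
      _ ≤ ‖h (circleLoop 0 R t)‖ := h2
  refine ⟨fun t ht h0 => ?_, (wind_eq_of_norm_sub_lt hcont h01 hloop hlt).trans hw⟩
  have := hlt t ht
  rw [h0, zero_sub, norm_neg] at this
  exact lt_irrefl _ this

/-! ### The contradiction -/

/-- **Core of the `δ`-regularised similarity principle.** Under the hypotheses of
`zeroFree_of_dbar_le` and `0 ≤ M`, a zero `η₀` of `G` is contradictory. With the radii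
`ρ₀ + 1 < ρ₀ + 2 < ρ₀ + 3`: let `m > 0` bound `‖G‖` below on the circle `‖z‖ = ρ₀ + 1`, let
`S = 2 (2ρ₀ + 3) M` and `b = e^{-S} m`, and choose `δ = t²` with `C e^S M t < b` (`C` the
constant of `exists_holomorphic_approx_of_dbar_le`). For the regularised coefficient `a` (smooth, `‖a‖ ≤ M`,
`‖r - a G‖ ≤ M t / 2`) and its Cauchy transform `s` (`∂̄ s = a`, `‖s‖ ≤ S` on `‖z‖ ≤ ρ₀ + 3`)
the function `h = e^{-s} G` has `‖∂̄ h‖ = ‖e^{-s} (r - a G)‖ ≤ e^S M t / 2`, so there is `H`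
holomorphic on `‖z‖ < ρ₀ + 2` with `‖h - H‖ ≤ C e^S M t / 2 < b / 2` on `‖z‖ ≤ ρ₀ + 2`; on the
circle `‖h‖ ≥ b` and `wind (h ∘ γ) = 0`, so by Rouché `H - H η₀` is zero-free on the circle with
winding number `0`, while it vanishes at `η₀` inside: impossible by the argument principle. [folklore] -/
theorem false_of_zero {G r : ℂ → ℂ} {M ρ₀ : ℝ} (hM : 0 ≤ M) (hG : ContDiff ℝ ∞ G)
    (hr : ContDiff ℝ ∞ r) (hdbar : ∀ η : ℂ, dbarAlong 1 G η = r η)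
    (hbound : ∀ η : ℂ, ‖r η‖ ≤ M * ‖G η‖) (hsupp : ∀ η : ℂ, ρ₀ ≤ ‖η‖ → r η = 0)
    (hfar : ∀ η : ℂ, ρ₀ ≤ ‖η‖ → ‖G η - 1‖ < 1) {η₀ : ℂ} (hz : G η₀ = 0) : False := by
  -- `G ≠ 0` where `ρ₀ ≤ ‖η‖`; the zero lies inside, so `0 < ρ₀`
  have hGne : ∀ η : ℂ, ρ₀ ≤ ‖η‖ → G η ≠ 0 := fun η hη h0 => by
    have := hfar η hη
    rw [h0, zero_sub, norm_neg, norm_one] at this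
    exact lt_irrefl _ this
  have hη₀ : ‖η₀‖ < ρ₀ := lt_of_not_ge fun h => hGne η₀ h hz
  have hρ₀ : 0 < ρ₀ := (norm_nonneg η₀).trans_lt hη₀
  -- the constant of approximate holomorphy for the radii `ρ₀ + 2 < ρ₀ + 3`
  obtain ⟨C, hC0, hC⟩ :=
    exists_holomorphic_approx_of_dbar_le (ρ₀ + 2) (ρ₀ + 3) (by linarith) (by linarith)
  -- a positive lower bound `m` for `‖G‖` on the circle `‖z‖ = ρ₀ + 1`
  obtain ⟨m, hm0, hm⟩ : ∃ m : ℝ, 0 < m ∧ ∀ z : ℂ, ‖z‖ = ρ₀ + 1 → m ≤ ‖G z‖ := by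
    obtain ⟨z₀, hz₀, hmin⟩ := (isCompact_sphere (0 : ℂ) (ρ₀ + 1)).exists_isMinOn
      ⟨((ρ₀ + 1 : ℝ) : ℂ), mem_sphere_zero_iff_norm.2 (Complex.norm_of_nonneg (by linarith))⟩
      hG.continuous.norm.continuousOn
    have hz₀' : ‖z₀‖ = ρ₀ + 1 := mem_sphere_zero_iff_norm.1 hz₀
    exact ⟨‖G z₀‖, norm_pos_iff.2 (hGne z₀ (by linarith)), fun z hz =>
      hmin (mem_sphere_zero_iff_norm.2 hz)⟩
  -- sizes: `S` bounds the potential, `b = e^{-S} m` bounds `‖h‖` below on the circle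
  set S : ℝ := 2 * ((ρ₀ + 3) + ρ₀) * M with hS_def
  set A : ℝ := C * Real.exp S * M with hA_def
  have hA0 : 0 ≤ A := by positivity
  set b : ℝ := Real.exp (-S) * m with hb_def
  have hb0 : 0 < b := by positivity
  -- the regularisation parameter `δ = t²`, chosen with `A t < b`
  set t : ℝ := b / (A + 1) with ht_def
  have ht0 : 0 < t := by positivity
  have hAt : A * t < b := by
    rw [ht_def, mul_div_assoc', div_lt_iff₀ (by positivity)]
    nlinarith
  -- the regularised coefficient
  obtain ⟨ha, hac, haM, har⟩ :=
    regularisedCoefficient G r M ρ₀ (t ^ 2) hM (by positivity) hG hr hbound hsupp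
  set a : ℂ → ℂ := fun η => r η * conj (G η) / (((‖G η‖ ^ 2 + t ^ 2 : ℝ)) : ℂ)
    with ha_def
  have ha0 : ∀ η : ℂ, ρ₀ ≤ ‖η‖ → a η = 0 := fun η hη => by simp [ha_def, hsupp η hη]
  have har' : ∀ η, ‖r η - a η * G η‖ ≤ M * t / 2 := fun η => by
    have := har η
    rwa [Real.sqrt_sq ht0.le] at this
  -- the potential
  obtain ⟨s, hs, hds, hsS⟩ :=
    exists_potential (ρ := ρ₀ + 3) hρ₀.le (by linarith) hM ha hac haM ha0
  have hsd : Differentiable ℝ s := hs.differentiable (by simp)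
  have hGd : Differentiable ℝ G := hG.differentiable (by simp)
  -- the modified function `h = e^{-s} G`: small `∂̄`, hence close to a holomorphic `H`
  set h : ℂ → ℂ := fun z => Complex.exp (-s z) * G z with hh_def
  have hh : ContDiff ℝ ∞ h := hs.neg.cexp.mul hG
  have hdh : ∀ z : ℂ, ‖z‖ ≤ ρ₀ + 3 → ‖dbarAlong 1 h z‖ ≤ Real.exp S * (M * t / 2) := by
    intro z hz
    rw [hh_def, dbarAlong_one_exp_neg_mul (hsd z) (hGd z), hdbar z, hds z, norm_mul]
    exact mul_le_mul (norm_exp_neg_le (hsS z hz)) (har' z) (norm_nonneg _) (Real.exp_pos S).le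
  obtain ⟨H, hH, hHh⟩ := hC h (Real.exp S * (M * t / 2)) hh (by positivity) hdh
  -- on the circle: `h` gives a loop of winding number `0` with `‖h‖ ≥ b`
  obtain ⟨hloop, hw⟩ := loop_exp_neg_mul (R := ρ₀ + 1) hs.continuous hG.continuous
    (fun t _ => hfar _ (by
      rw [mem_sphere_zero_iff_norm.1 (circleLoop_mem_sphere 0 (by linarith) t)]
      linarith))
  have hlow : ∀ z : ℂ, ‖z‖ = ρ₀ + 1 → b ≤ ‖h z‖ := fun z hz' => by
    rw [hh_def, norm_mul]
    exact mul_le_mul (exp_neg_le_norm_exp_neg (hsS z (by linarith))) (hm z hz') hm0.le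
      (norm_nonneg _)
  -- Rouché: `H - H η₀` is zero-free on the circle, with winding number `0`
  obtain ⟨hne, hw0⟩ := wind_sub_eq_zero (h := h) (e := C * (Real.exp S * (M * t / 2)))
    (by linarith) (by linarith : ρ₀ + 1 < ρ₀ + 2) hH hloop hw hlow
    (fun z hz' => hHh z (by linarith)) (by linarith : ‖η₀‖ ≤ ρ₀ + 1)
    (by simp [hh_def, hz]) (by
      have : 2 * (C * (Real.exp S * (M * t / 2))) = A * t := by rw [hA_def]; ring
      linarith)
  -- the argument principle: `H - H η₀` vanishes at `η₀` inside the circle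
  exact wind_circleLoop_ne_zero_of_zero (fun z => H z - H η₀) (by linarith)
    (by linarith : ρ₀ + 1 < ρ₀ + 2) (hH.sub_const _) (by linarith) (sub_self _) hne hw0

end Similarity

/-- **The `δ`-regularised similarity principle, global zero-free form.** A smooth `G : ℂ → ℂ`
with `∂̄ G = r`, `‖r‖ ≤ M ‖G‖`, `r = 0` and `‖G - 1‖ < 1` for `‖η‖ ≥ ρ₀`, has no zero. (`0 ≤ M`
is forced by testing `‖r‖ ≤ M ‖G‖` at the far point `|ρ₀|`, where `G ≠ 0`; then
`Similarity.false_of_zero` applies.) [folklore] -/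
theorem zeroFree_of_dbar_le (G r : ℂ → ℂ) (M ρ₀ : ℝ) (hG : ContDiff ℝ ∞ G) (hr : ContDiff ℝ ∞ r)
    (hdbar : ∀ η : ℂ, dbarAlong 1 G η = r η)
    (hbound : ∀ η : ℂ, ‖r η‖ ≤ M * ‖G η‖)
    (hsupp : ∀ η : ℂ, ρ₀ ≤ ‖η‖ → r η = 0)
    (hfar : ∀ η : ℂ, ρ₀ ≤ ‖η‖ → ‖G η - 1‖ < 1) : ∀ η : ℂ, G η ≠ 0 := by
  intro η₀ hz
  -- `0 ≤ M`, tested at the far point `|ρ₀|`, where `G ≠ 0`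
  have hM : 0 ≤ M := by
    have h1 := hfar ((|ρ₀| : ℝ) : ℂ) (by
      rw [Complex.norm_of_nonneg (abs_nonneg ρ₀)]
      exact le_abs_self ρ₀)
    have hG1 : G ((|ρ₀| : ℝ) : ℂ) ≠ 0 := fun h0 => by
      rw [h0, zero_sub, norm_neg, norm_one] at h1
      exact lt_irrefl _ h1
    have h2 := (norm_nonneg _).trans (hbound ((|ρ₀| : ℝ) : ℂ))
    exact nonneg_of_mul_nonneg_left h2 (norm_pos_iff.2 hG1)
  exact Similarity.false_of_zero hM hG hr hdbar hbound hsupp hfar hz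

/-- **Normalisation-free form.** A smooth `G : ℂ → ℂ` with `∂̄ G = r`, `‖r‖ ≤ M ‖G‖`, `r = 0`
and `‖G - c₀‖ < ‖c₀‖` for `‖η‖ ≥ ρ₀`, where `c₀ ≠ 0` is a constant, has no zero (apply
`zeroFree_of_dbar_le` to `G / c₀`, `r / c₀`). [folklore] -/
theorem zeroFree_of_dbar_le_of_norm_sub_const_lt (G r : ℂ → ℂ) (M ρ₀ : ℝ) {c₀ : ℂ}
    (hc₀ : c₀ ≠ 0) (hG : ContDiff ℝ ∞ G) (hr : ContDiff ℝ ∞ r)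
    (hdbar : ∀ η : ℂ, dbarAlong 1 G η = r η)
    (hbound : ∀ η : ℂ, ‖r η‖ ≤ M * ‖G η‖)
    (hsupp : ∀ η : ℂ, ρ₀ ≤ ‖η‖ → r η = 0)
    (hfar : ∀ η : ℂ, ρ₀ ≤ ‖η‖ → ‖G η - c₀‖ < ‖c₀‖) : ∀ η : ℂ, G η ≠ 0 := by
  have hc : ‖c₀‖ ≠ 0 := norm_ne_zero_iff.2 hc₀
  have hGd : Differentiable ℝ G := hG.differentiable (by simp)
  have key := zeroFree_of_dbar_le (fun η => c₀⁻¹ * G η) (fun η => c₀⁻¹ * r η) M ρ₀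
    (contDiff_const.mul hG) (contDiff_const.mul hr) (fun η => ?_) (fun η => ?_) (fun η hη => ?_)
    (fun η hη => ?_)
  · intro η h0
    exact key η (by simp [h0])
  · -- `∂̄ (c₀⁻¹ G) = c₀⁻¹ ∂̄ G`
    have hfun : (fun η => c₀⁻¹ * G η) = c₀⁻¹ • G := by
      funext x
      simp [smul_eq_mul]
    have h := dbarAlong_const_smul (F := ℂ) (hGd η) c₀⁻¹ (1 : ℂ)
    rw [hfun, h, hdbar η, smul_eq_mul]
  · rw [norm_mul, norm_mul, mul_left_comm]
    exact mul_le_mul_of_nonneg_left (hbound η) (norm_nonneg _)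
  · simp [hsupp η hη]
  · have h1 := hfar η hη
    have h2 : c₀⁻¹ * G η - 1 = c₀⁻¹ * (G η - c₀) := by field_simp
    rw [h2, norm_mul, norm_inv, inv_mul_lt_iff₀ (norm_pos_iff.2 hc₀), mul_one]
    exact h1

end Literature.Analysis.Complex

end
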